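import Summits.CriticalPhenomena.CardyFormulaZ2.Theorems.CardyMeckeFlipLawToCrossingsUpper
import Summits.CriticalPhenomena.CardyFormulaZ2.Theorems.CardyIKTransportCrudeToCanonical
import Literature.Probability.RandomPlanarGeometry.CrossRatioContinuity
import Summits.CriticalPhenomena.CardyFormulaZ2.Theorems.CardyBoundaryCoulombGasRectilinearSufficesSquareModel
import HarnessLib

/-!
# Stub `stub_domainContinuity` (S2), part 1: geometry of `ε₀`-close conformal rectangles and the
# upper cross-domain inclusion

Crux `Summit.CriticalPhenomena.CardyFormulaZ2.Theses.CardyWickAnisotropy.BoxFamilyToCardy`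
(stmt-CriticalPhenomena-14215), line `registered`, stub `stub_domainContinuity` (shared verbatim
with stmt-CriticalPhenomena-0794): mesh-uniform continuity of G02's crossing probability
`bondDomainCrossingProb` in the marked-loop topology. This first helper file records:

* the **closeness scale** `exists_closeness_scale`: for a conformal rectangle `R` and `ρ > 0`
  there is `ε₀ > 0` such that every conformal rectangle `Q` whose boundary loop is pointwise
  `ε₀`-close to that of `R` and whose mark parameters are `ε₀`-close has its arcs within `ρ` of
  the corresponding arcs of `R` and conversely, its frontier within `ρ` of `∂R`, and
  `Q △ R ⊆ N_ρ(∂R)` (dog-on-leash: `JordanDomain.mem_carrier_of_dist_boundary_lt` and its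
  converse `mem_carrier_of_mem_carrier_of_dist_boundary_lt`, by the index of the boundary loop,
  `Theorems.index_eq_index_of_dist_boundary_lt_of_not_mem`);
* the **upper cross-domain inclusion** `discrete_subset_crossed_near`: for a square model `Φ` of
  `R`, `H = (i·) ∘ Φ` and `s ∈ (0, 1/2]`, uniformly over all `Q` `ε₀`-close to `R` and all small
  meshes, a G02 crossing of `Q` (open path of `Q_δ` between the discrete arcs of `Q.arc 0`,
  `Q.arc 2`) forces the easier quad `rectQuad H (1-s) (1+s)` of `R` into `S_ω` — the proof of
  `MeckeFlipBridge.crude_subset_crossed` with the slack `ρ` absorbed into the straightening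
  tolerance.

References: O. Schramm, S. Smirnov, Ann. Probab. 39 (2011), §1.3 and proof of Lemma 5.1;
L. V. Ahlfors, *Complex Analysis* (1979), Ch. 4 §2.1 (winding number, dog-on-leash);
S. Smirnov, C. R. Acad. Sci. Paris 333 (2001), §2.
-/

noncomputable section

namespace Summit.CriticalPhenomena.CardyFormulaZ2.Cruxes.BoxFamilyToCardy.Birth

open Set Filter MeasureTheory Metric Complex
open scoped Topology
open Literature.Probability.Percolation hiding cardyFunction
open Literature.Probability.Percolation.QuadCrossing
open Literature.Probability.RandomPlanarGeometry hiding cardyFunction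
open Literature.Probability.LatticeModels
open Literature.Topology.PlaneTopology
open Summit.CriticalPhenomena.CardyFormulaZ2.Theorems
open Summit.CriticalPhenomena.CardyFormulaZ2.Theorems.MeckeFlipBridge

/-! ### Dog-on-leash: interior points of the perturbed domain far from `∂R` are interior to `R` -/

/-- **Dog-on-leash, converse direction.** If the boundary loop of `D'` is pointwise closer to that
of `D` than the distance from `z₀ ∈ D'` to `∂D`, then `z₀ ∈ D`: otherwise `z₀` is exterior to `D`,
of index `0` for `∂D` (`index_eq_zero_of_mem_exterior`), hence for `∂D'`
(`index_eq_index_of_dist_boundary_lt_of_not_mem`), contradicting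
`index_ne_zero_of_mem_carrier`. [cite: AhlforsCA1979, Ch. 4 §2.1] -/
theorem mem_carrier_of_mem_carrier_of_dist_boundary_lt (D D' : JordanDomain) {z₀ : ℂ}
    (hz₀ : z₀ ∈ D'.carrier)
    (hclose : ∀ t, dist (D'.boundary t) (D.boundary t) < infDist z₀ (frontier D.carrier)) :
    z₀ ∈ D.carrier := by
  have hfr : z₀ ∉ frontier D.carrier := fun hmem ↦ by
    have h0 := hclose 0
    rw [infDist_zero_of_mem hmem] at h0
    exact absurd h0 (not_lt.2 dist_nonneg)
  by_contra hout
  have hext : z₀ ∈ (closure D.carrier)ᶜ := by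
    rw [closure_eq_self_union_frontier]
    rintro (h1 | h1)
    · exact hout h1
    · exact hfr h1
  have h0 : D'.index z₀ = 0 := by
    rw [index_eq_index_of_dist_boundary_lt_of_not_mem D D' hfr hclose]
    exact D.index_eq_zero_of_mem_exterior hext
  exact D'.index_ne_zero_of_mem_carrier hz₀ h0

/-! ### Mark parameters of close conformal rectangles -/

/-- Clamping a parameter of `[a, b]` into an interval `[a', b']` with `ε`-close endpoints moves it
by at most `ε`. [folklore] -/
theorem clamp_mem_Icc_and_abs_sub_le {a b a' b' u ε : ℝ} (hab' : a' ≤ b') (ha : |a' - a| ≤ ε)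
    (hb : |b' - b| ≤ ε) (hu : u ∈ Icc a b) :
    max a' (min u b') ∈ Icc a' b' ∧ |u - max a' (min u b')| ≤ ε := by
  refine ⟨⟨le_max_left _ _, max_le hab' (min_le_right _ _)⟩, ?_⟩
  rw [abs_le] at ha hb ⊢
  obtain ⟨hu1, hu2⟩ := hu
  rcases le_total u b' with h1 | h1
  · rw [min_eq_left h1]
    rcases le_total a' u with h2 | h2
    · rw [max_eq_right h2]; constructor <;> linarith
    · rw [max_eq_left h2]; constructor <;> linarith
  · rw [min_eq_right h1, max_eq_right hab']
    constructor <;> linarith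

/-- The `nextMark` parameters of conformal rectangles with `ε₀`-close marks are `ε₀`-close.
[folklore] -/
theorem abs_nextMark_sub_le {Q R : ConformalRectangle} {ε₀ : ℝ}
    (hm : ∀ i : Fin 4, |Q.mark i - R.mark i| ≤ ε₀) (i : Fin 4) :
    |Q.nextMark i - R.nextMark i| ≤ ε₀ := by
  unfold MarkedDomain.nextMark
  split_ifs with h1
  · exact hm _
  · rw [add_sub_add_right_eq_sub]; exact hm _

/-- The parameter interval of every arc lies in `[-1, 3]`. [folklore] -/
theorem Icc_mark_subset (D : ConformalRectangle) (i : Fin 4) :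
    Icc (D.mark i) (D.nextMark i) ⊆ Icc (-1 : ℝ) 3 := by
  refine Icc_subset_Icc ?_ ?_
  · linarith [(D.mark_mem i).1]
  · linarith [(D.mark_mem i).2, D.nextMark_le_mark_add_one i]

/-- Uniform continuity of the boundary loop on the parameter window `[-1, 3]`. [folklore] -/
theorem exists_forall_dist_boundary_lt (D : ConformalRectangle) {η : ℝ} (hη : 0 < η) :
    ∃ θ : ℝ, 0 < θ ∧ ∀ u ∈ Icc (-1 : ℝ) 3, ∀ v ∈ Icc (-1 : ℝ) 3, dist u v < θ →
      dist (D.boundary u) (D.boundary v) < η := by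
  obtain ⟨θ, hθ, hθc⟩ := Metric.uniformContinuousOn_iff.1
    (isCompact_Icc.uniformContinuousOn_of_continuous D.continuous_boundary.continuousOn) η hη
  exact ⟨θ, hθ, fun u hu v hv huv ↦ hθc u hu v hv huv⟩

/-! ### Arcs of close conformal rectangles are close -/

/-- **The arcs of `Q` lie near the corresponding arcs of `R`**: a point `Q.boundary u` of
`Q.arc i` is `ε₀`-close to `R.boundary u`, and `u` clamped into the parameter interval of
`R.arc i` moves by at most `ε₀ < θ`, the uniform-continuity radius of `R.boundary`. [folklore] -/
theorem exists_mem_arc_dist_lt {Q R : ConformalRectangle} {ε₀ η θ : ℝ}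
    (hθ : ∀ u ∈ Icc (-1 : ℝ) 3, ∀ v ∈ Icc (-1 : ℝ) 3, dist u v < θ →
      dist (R.boundary u) (R.boundary v) < η)
    (hε₀θ : ε₀ < θ) (hb : ∀ u : ℝ, dist (Q.boundary u) (R.boundary u) ≤ ε₀)
    (hm : ∀ i : Fin 4, |Q.mark i - R.mark i| ≤ ε₀) (i : Fin 4) :
    ∀ z ∈ Q.arc i, ∃ z' ∈ R.arc i, dist z z' < ε₀ + η := by
  rintro _ ⟨u, hu, rfl⟩
  have hm' : |R.mark i - Q.mark i| ≤ ε₀ := by rw [abs_sub_comm]; exact hm i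
  have hn' : |R.nextMark i - Q.nextMark i| ≤ ε₀ := by
    rw [abs_sub_comm]; exact abs_nextMark_sub_le hm i
  obtain ⟨hu'mem, huu'⟩ := clamp_mem_Icc_and_abs_sub_le (R.mark_lt_nextMark i).le hm' hn' hu
  refine ⟨R.boundary (max (R.mark i) (min u (R.nextMark i))), mem_image_of_mem _ hu'mem, ?_⟩
  have h1 : dist (R.boundary u) (R.boundary (max (R.mark i) (min u (R.nextMark i)))) < η :=
    hθ u (Icc_mark_subset Q i hu) _ (Icc_mark_subset R i hu'mem)
      (by rw [Real.dist_eq]; exact huu'.trans_lt hε₀θ)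
  calc dist (Q.boundary u) (R.boundary (max (R.mark i) (min u (R.nextMark i))))
      ≤ dist (Q.boundary u) (R.boundary u) +
          dist (R.boundary u) (R.boundary (max (R.mark i) (min u (R.nextMark i)))) :=
        dist_triangle _ _ _
    _ < ε₀ + η := add_lt_add_of_le_of_lt (hb u) h1

/-- **The arcs of `R` lie near the corresponding arcs of `Q`** (same argument, clamping the
parameter into the interval of `Q.arc i`). [folklore] -/
theorem exists_mem_arc_dist_lt' {Q R : ConformalRectangle} {ε₀ η θ : ℝ}
    (hθ : ∀ u ∈ Icc (-1 : ℝ) 3, ∀ v ∈ Icc (-1 : ℝ) 3, dist u v < θ →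
      dist (R.boundary u) (R.boundary v) < η)
    (hε₀θ : ε₀ < θ) (hb : ∀ u : ℝ, dist (Q.boundary u) (R.boundary u) ≤ ε₀)
    (hm : ∀ i : Fin 4, |Q.mark i - R.mark i| ≤ ε₀) (i : Fin 4) :
    ∀ z ∈ R.arc i, ∃ z' ∈ Q.arc i, dist z z' < ε₀ + η := by
  rintro _ ⟨u, hu, rfl⟩
  obtain ⟨hu'mem, huu'⟩ :=
    clamp_mem_Icc_and_abs_sub_le (Q.mark_lt_nextMark i).le (hm i) (abs_nextMark_sub_le hm i) hu
  refine ⟨Q.boundary (max (Q.mark i) (min u (Q.nextMark i))), mem_image_of_mem _ hu'mem, ?_⟩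
  have h1 : dist (R.boundary u) (R.boundary (max (Q.mark i) (min u (Q.nextMark i)))) < η :=
    hθ u (Icc_mark_subset R i hu) _ (Icc_mark_subset Q i hu'mem)
      (by rw [Real.dist_eq]; exact huu'.trans_lt hε₀θ)
  calc dist (R.boundary u) (Q.boundary (max (Q.mark i) (min u (Q.nextMark i))))
      ≤ dist (R.boundary u) (R.boundary (max (Q.mark i) (min u (Q.nextMark i)))) +
          dist (R.boundary (max (Q.mark i) (min u (Q.nextMark i))))
            (Q.boundary (max (Q.mark i) (min u (Q.nextMark i)))) := dist_triangle _ _ _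
    _ < η + ε₀ := add_lt_add_of_lt_of_le h1 (by rw [dist_comm]; exact hb _)
    _ = ε₀ + η := add_comm _ _

/-! ### The closeness scale -/

/-- **Closeness scale of a conformal rectangle.** For `ρ > 0` there is `ε₀ > 0` such that every
conformal rectangle `Q` with boundary loop pointwise `ε₀`-close to `R.boundary` and mark
parameters `ε₀`-close to `R.mark` satisfies: each arc of `Q` is within `ρ` of the corresponding
arc of `R` and conversely; `∂Q` is within `ρ` of `∂R`; points of `Q ∖ R` and of `R ∖ Q` are
within `ρ` of `∂R` (dog-on-leash in both directions). [cite: AhlforsCA1979, Ch. 4 §2.1] -/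
theorem exists_closeness_scale (R : ConformalRectangle) {ρ : ℝ} (hρ : 0 < ρ) :
    ∃ ε₀ : ℝ, 0 < ε₀ ∧ ∀ Q : ConformalRectangle,
      (∀ u : ℝ, dist (Q.boundary u) (R.boundary u) ≤ ε₀) →
      (∀ i : Fin 4, |Q.mark i - R.mark i| ≤ ε₀) →
      (∀ i : Fin 4, ∀ z ∈ Q.arc i, ∃ z' ∈ R.arc i, dist z z' < ρ) ∧
      (∀ i : Fin 4, ∀ z ∈ R.arc i, ∃ z' ∈ Q.arc i, dist z z' < ρ) ∧
      (∀ z ∈ frontier Q.carrier, ∃ z' ∈ frontier R.carrier, dist z z' < ρ) ∧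
      (∀ z ∈ Q.carrier, z ∉ R.carrier → ∃ z' ∈ frontier R.carrier, dist z z' < ρ) ∧
      (∀ z ∈ R.carrier, z ∉ Q.carrier → ∃ z' ∈ frontier R.carrier, dist z z' < ρ) := by
  obtain ⟨θ, hθ, hθc⟩ := exists_forall_dist_boundary_lt R (half_pos hρ)
  refine ⟨min (ρ / 4) (θ / 2), lt_min (by positivity) (by positivity), fun Q hb hm ↦ ?_⟩
  have hε₀ρ : min (ρ / 4) (θ / 2) ≤ ρ / 4 := min_le_left _ _
  have hε₀θ : min (ρ / 4) (θ / 2) < θ := (min_le_right _ _).trans_lt (half_lt_self hθ)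
  have hsum : min (ρ / 4) (θ / 2) + ρ / 2 < ρ := by linarith
  have hne : (frontier R.carrier).Nonempty := ⟨_, R.boundary_mem_frontier 0⟩
  refine ⟨fun i z hz ↦ ?_, fun i z hz ↦ ?_, fun z hz ↦ ?_, fun z hz hzR ↦ ?_, fun z hz hzQ ↦ ?_⟩
  · obtain ⟨z', hz', hd⟩ := exists_mem_arc_dist_lt hθc hε₀θ hb hm i z hz
    exact ⟨z', hz', hd.trans hsum⟩
  · obtain ⟨z', hz', hd⟩ := exists_mem_arc_dist_lt' hθc hε₀θ hb hm i z hz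
    exact ⟨z', hz', hd.trans hsum⟩
  · rw [← Q.range_boundary] at hz
    obtain ⟨u, rfl⟩ := hz
    exact ⟨R.boundary u, R.boundary_mem_frontier u, (hb u).trans_lt (by linarith)⟩
  · by_contra hcon
    push Not at hcon
    have hle : ρ ≤ infDist z (frontier R.carrier) := (le_infDist hne).2 hcon
    exact hzR (mem_carrier_of_mem_carrier_of_dist_boundary_lt R.toJordanDomain Q.toJordanDomain
      hz fun t ↦ (hb t).trans_lt (by linarith))
  · by_contra hcon
    push Not at hcon
    have hle : ρ ≤ infDist z (frontier R.carrier) := (le_infDist hne).2 hcon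
    exact hzQ (JordanDomain.mem_carrier_of_dist_boundary_lt R.toJordanDomain Q.toJordanDomain
      hz fun t ↦ (hb t).trans_lt (by linarith))

/-- The distance to a set `A'` that is pointwise `ρ`-close to a nonempty set `A` exceeds the
distance to `A` by at most `ρ`. [folklore] -/
theorem infDist_le_infDist_add_of_forall_exists {x : ℂ} {A A' : Set ℂ} {ρ : ℝ} (hA : A.Nonempty)
    (h : ∀ z ∈ A, ∃ z' ∈ A', dist z z' < ρ) : infDist x A' ≤ infDist x A + ρ := by
  refine le_of_forall_pos_lt_add fun ε hε ↦ ?_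
  obtain ⟨a, ha, hxa⟩ := (infDist_lt_iff hA).1 (lt_add_of_pos_right (infDist x A) hε)
  obtain ⟨a', ha', haa'⟩ := h a ha
  calc infDist x A' ≤ dist x a' := infDist_le_dist_of_mem ha'
    _ ≤ dist x a + dist a a' := dist_triangle _ _ _
    _ < infDist x A + ε + ρ := by linarith
    _ = infDist x A + ρ + ε := by ring

/-! ### The upper cross-domain inclusion -/

/-- **A G02 crossing of a nearby conformal rectangle forces the easier quad of `R` to be crossed,
uniformly.** Let `Φ` be a square model of `R`, `H = (i·) ∘ Φ`, `s ∈ (0, 1/2]`. There are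
`ε₀ > 0` and `δ₀ > 0` such that for every conformal rectangle `Q` `ε₀`-close to `R` (boundary
loops pointwise, mark parameters), every mesh `0 < δ < δ₀` and every lattice configuration `ω`
with a G02 crossing of `Q` (open path of the largest mesh component `Q_δ` between the discrete
arcs of `Q.arc 0`, `Q.arc 2`), the quad `rectQuad H (1-s) (1+s)` belongs to `S_ω`: the crossing
is an open lattice path with vertices in `Q ⊆ N_ρ(closure R)` from within `2δ + ρ` of `R.arc 0`
to within `2δ + ρ` of `R.arc 2`; read through `H⁻¹` its drawn polyline is a continuum in the
band `|Im| ≤ 1 + η` joining `{Re ≤ -1+η}` to `{Re ≥ 1-η}`, hence contains a crossing of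
`[-(1-s), 1-s] × [-(1+s), 1+s]` (`exists_subcontinuum_crossing`).
[cite: SchrammSmirnov2011, §1.3 and proof of Lemma 5.1] [cite: Smirnov2001, §2] -/
theorem discrete_subset_crossed_near :
    ∀ (R : Literature.Probability.RandomPlanarGeometry.ConformalRectangle) (Φ : ℂ ≃ₜ ℂ), Literature.Probability.Percolation.IsSquareModel R Φ → ∀ (s : ℝ) (hs : 0 < s) (hs' : s ≤ 1 / 2), ∃ ε₀ : ℝ, 0 < ε₀ ∧ ∃ δ₀ : ℝ, 0 < δ₀ ∧ ∀ Q : Literature.Probability.RandomPlanarGeometry.ConformalRectangle, (∀ u : ℝ, dist (Q.boundary u) (R.boundary u) ≤ ε₀) → (∀ i : Fin 4, |Q.mark i - R.mark i| ≤ ε₀) → ∀ δ : ℝ, 0 < δ → δ < δ₀ → ∀ ω : Literature.Probability.Percolation.BondConfig (Literature.Probability.LatticeModels.Site 2), ω ⊆ (Literature.Probability.LatticeModels.zdGraph 2).edgeSet → ω ∈ Literature.Probability.Percolation.discreteCrossing Q.carrier δ (Q.arc 0) (Q.arc 2) → Literature.Probability.Percolation.QuadCrossing.Quad.rectQuad ((Homeomorph.mulLeft₀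 Complex.I Complex.I_ne_zero).trans Φ) (1 - s) (1 + s) (sub_pos.2 (hs'.trans_lt one_half_lt_one)) (add_pos one_pos hs) (fun _ => Set.mem_univ _) ∈ Literature.Probability.Percolation.z2QuadConfig Set.univ δ ω := by
  intro R Φ h s hs hs'
  set H : ℂ ≃ₜ ℂ := (Homeomorph.mulLeft₀ Complex.I Complex.I_ne_zero).trans Φ with hH
  -- the straightening tolerance `η` and the uniform-continuity radius `θ` of `H⁻¹`
  set η : ℝ := s / 8 with hη
  have hηpos : 0 < η := by positivity
  have hηs : 4 * η < s := by rw [hη]; linarith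
  have hCc : IsCompact (closure R.carrier) := R.isBounded.isCompact_closure
  obtain ⟨θ, hθ, -, hUC⟩ := exists_forall_dist_symm_lt H hCc hηpos
  -- opposite arcs of `R` are at positive distance
  obtain ⟨ε, hε, hεd⟩ := R.exists_pos_forall_lt_dist_arc
  -- the closeness scale
  obtain ⟨ε₀, hε₀, hscale⟩ :=
    exists_closeness_scale R (ρ := min (θ / 3) (ε / 4)) (lt_min (by positivity) (by positivity))
  have hρθ : min (θ / 3) (ε / 4) ≤ θ / 3 := min_le_left _ _
  have hρε : min (θ / 3) (ε / 4) ≤ ε / 4 := min_le_right _ _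
  refine ⟨ε₀, hε₀, min (θ / 3) (ε / 8), lt_min (by positivity) (by positivity), ?_⟩
  intro Q hb hm δ hδ hδlt ω hω hωQ
  obtain ⟨hC1, -, -, hC3, -⟩ := hscale Q hb hm
  have hδθ : δ < θ / 3 := hδlt.trans_le (min_le_left _ _)
  have hδε : δ < ε / 8 := hδlt.trans_le (min_le_right _ _)
  -- the G02 crossing of `Q` is a crude crossing of `Q`
  obtain ⟨u, hu, v, hv, huS, hvS, hreach⟩ :=
    discreteCrossing_subset_openCrossing Q.isOpen hδ (Q.arc 0) (Q.arc 2) hωQ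
  simp only [mem_setOf_eq] at hu hv
  have h22 : Real.sqrt 2 ≤ 2 := Real.sqrt_two_lt_three_halves.le.trans (by norm_num)
  have hu2 : infDist (meshPoint δ u) (Q.arc 0) ≤ 2 * δ :=
    hu.trans (mul_le_mul_of_nonneg_right h22 hδ.le)
  have hv2 : infDist (meshPoint δ v) (Q.arc 2) ≤ 2 * δ :=
    hv.trans (mul_le_mul_of_nonneg_right h22 hδ.le)
  -- nearest points on the arcs of `Q`, and nearby points on the arcs of `R`
  obtain ⟨q₀, hq₀, hq₀d⟩ := (Q.isCompact_arc 0).exists_infDist_eq_dist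
    ⟨Q.pt 0, Q.pt_mem_arc_self 0⟩ (meshPoint δ u)
  obtain ⟨q₂, hq₂, hq₂d⟩ := (Q.isCompact_arc 2).exists_infDist_eq_dist
    ⟨Q.pt 2, Q.pt_mem_arc_self 2⟩ (meshPoint δ v)
  have hdu : dist (meshPoint δ u) q₀ ≤ 2 * δ := hq₀d ▸ hu2
  have hdv : dist (meshPoint δ v) q₂ ≤ 2 * δ := hq₂d ▸ hv2
  obtain ⟨p₀, hp₀, hqp₀⟩ := hC1 0 q₀ hq₀
  obtain ⟨p₂, hp₂, hqp₂⟩ := hC1 2 q₂ hq₂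
  have hdu' : dist (meshPoint δ u) p₀ < 2 * δ + θ / 3 := by
    linarith [dist_triangle (meshPoint δ u) q₀ p₀]
  have hdv' : dist (meshPoint δ v) p₂ < 2 * δ + θ / 3 := by
    linarith [dist_triangle (meshPoint δ v) q₂ p₂]
  -- the drawn polyline of the open path
  obtain ⟨W⟩ := hreach
  obtain ⟨L, hLc, hLconn, huL, hvL, hnear, hLO⟩ := exists_polyline_of_walk hδ hω W
  -- it is not trivial: `u ≠ v` since the arcs `0`, `2` of `R` are `ε` apart
  have hLO' : L ⊆ openEdgeUnion δ ω := by
    rcases hLO with hLO | hLO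
    · exfalso
      have hvu : meshPoint δ v = meshPoint δ u := by
        have hvL' := hvL; rw [hLO] at hvL'; exact mem_singleton_iff.1 hvL'
      have h1 := hεd p₀ hp₀ p₂ hp₂
      have h2 : dist p₀ p₂ ≤ dist p₀ (meshPoint δ u) + dist (meshPoint δ u) p₂ :=
        dist_triangle _ _ _
      have h3 : dist (meshPoint δ u) p₂ < 2 * δ + ε / 4 := by
        rw [← hvu]; linarith [dist_triangle (meshPoint δ v) q₂ p₂]
      have h4 : dist p₀ (meshPoint δ u) < 2 * δ + ε / 4 := by
        rw [dist_comm]; linarith [dist_triangle (meshPoint δ u) q₀ p₀]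
      linarith
    · exact hLO
  -- every point of the polyline is within `θ` of the closed quad of `R`
  have hLnear : ∀ z ∈ L, ∃ q ∈ closure R.carrier, dist z q < θ := by
    intro z hz
    obtain ⟨x, hxS, hxd⟩ := hnear z hz
    by_cases hxR : meshPoint δ x ∈ R.carrier
    · exact ⟨_, subset_closure hxR, hxd.trans_lt (by linarith)⟩
    · obtain ⟨f, hf, hfd⟩ := hC3 _ hxS hxR
      exact ⟨f, frontier_subset_closure hf, by linarith [dist_triangle z (meshPoint δ x) f]⟩
  -- read through `H⁻¹`
  set K : Set ℂ := H.symm '' L with hK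
  have hKc : IsCompact K := hLc.image H.symm.continuous
  have hKconn : IsConnected K := hLconn.image _ H.symm.continuous.continuousOn
  have hKim : ∀ w ∈ K, |w.im| ≤ 1 + η := by
    rintro _ ⟨z, hz, rfl⟩
    obtain ⟨q, hq, hzq⟩ := hLnear z hz
    have hlt : dist (H.symm z) (H.symm q) < η := hUC _ hq z hzq
    have hsq := symm_image_closure h _ hq
    rw [mem_reProdIm, mem_Icc, mem_Icc] at hsq
    have him := (abs_im_le_norm (H.symm z - H.symm q)).trans_lt (by rwa [← dist_eq_norm])
    rw [sub_im] at him
    exact abs_le.2 ⟨by linarith [(abs_lt.1 him).1, hsq.2.1], by linarith [(abs_lt.1 him).2, hsq.2.2]⟩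
  have hK₀ : ∃ w ∈ K, w.re ≤ -1 + η := by
    refine ⟨H.symm (meshPoint δ u), mem_image_of_mem _ huL, ?_⟩
    have hq : p₀ ∈ closure R.carrier :=
      R.arc_subset_frontier 0 |>.trans frontier_subset_closure <| hp₀
    have hlt : dist (H.symm (meshPoint δ u)) (H.symm p₀) < η :=
      hUC _ hq _ (hdu'.trans_le (by linarith))
    have hre := (abs_re_le_norm (H.symm (meshPoint δ u) - H.symm p₀)).trans_lt
      (by rwa [← dist_eq_norm])
    rw [sub_re, symm_image_arc_zero h p₀ hp₀] at hre
    linarith [(abs_lt.1 hre).2]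
  have hK₂ : ∃ w ∈ K, 1 - η ≤ w.re := by
    refine ⟨H.symm (meshPoint δ v), mem_image_of_mem _ hvL, ?_⟩
    have hq : p₂ ∈ closure R.carrier :=
      R.arc_subset_frontier 2 |>.trans frontier_subset_closure <| hp₂
    have hlt : dist (H.symm (meshPoint δ v)) (H.symm p₂) < η :=
      hUC _ hq _ (hdv'.trans_le (by linarith))
    have hre := (abs_re_le_norm (H.symm (meshPoint δ v) - H.symm p₂)).trans_lt
      (by rwa [← dist_eq_norm])
    rw [sub_re, symm_image_arc_two h p₂ hp₂] at hre
    linarith [(abs_lt.1 hre).1]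
  -- the band lemma, with the identity as chart
  obtain ⟨K', hK'K, hK'c, hK'conn, hK'sub, hK'0, hK'2⟩ :=
    exists_subcontinuum_crossing (g := id) hs' hηpos hηs continuousOn_id (injOn_id _)
      (fun z _ => by simp [hηpos.le]) hKc hKconn hKim hK₀ hK₂
  rw [image_id] at hK'sub
  simp only [image_id] at hK'0 hK'2
  -- push forward by `H`: a crossing of `Q_{1-s,1+s}` inside the open edges
  refine mem_z2QuadConfig_of_isCrossing (K := H '' K') ⟨hK'c.image H.continuous,
    hK'conn.image _ H.continuous.continuousOn, ?_, ?_, ?_⟩ ?_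
  · rw [carrier_rq]
    exact image_mono hK'sub
  · obtain ⟨w, hwK', hw⟩ := hK'0
    refine ⟨H w, mem_image_of_mem _ hwK', ?_⟩
    rw [side_zero_rq]
    refine mem_image_of_mem _ ⟨hw.2, ?_⟩
    have hw1 := hw.1
    rw [mem_reProdIm] at hw1
    exact hw1.2
  · obtain ⟨w, hwK', hw⟩ := hK'2
    refine ⟨H w, mem_image_of_mem _ hwK', ?_⟩
    rw [side_two_rq]
    refine mem_image_of_mem _ ⟨hw.2, ?_⟩
    have hw1 := hw.1
    rw [mem_reProdIm] at hw1
    exact hw1.2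
  · rintro _ ⟨w, hw, rfl⟩
    obtain ⟨z, hz, hzw⟩ := hK'K hw
    rw [← hzw, Homeomorph.apply_symm_apply]
    exact hLO' hz

end Summit.CriticalPhenomena.CardyFormulaZ2.Cruxes.BoxFamilyToCardy.Birth

end
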